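import Summits.BirchSwinnertonDyer.BirchSwinnertonDyer.Theorems.PrintCFramBottomClassIndexLawFiveLeEisensteinPairBernoulli
import Summits.BirchSwinnertonDyer.BirchSwinnertonDyer.Theorems.PrintCFramBottomClassIndexLawFiveLeKrizLiBindersKroneckerField
import Summits.BirchSwinnertonDyer.BirchSwinnertonDyer.Theorems.PrintCFramBottomClassIndexLawFiveLeKrizLiBindersKroneckerEven
import Summits.BirchSwinnertonDyer.BirchSwinnertonDyer.Theorems.PrintCFramBottomClassIndexLawFiveLeBernoulliUnitsOfKrizLiClass
import Summits.BirchSwinnertonDyer.BirchSwinnertonDyer.Theorems.PrintCFramBottomClassIndexLawFiveLeRegularLocusBernoulliPairOdd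
import Literature.NumberTheory.QuadraticFields.FundamentalDiscriminant
import Literature.NumberTheory.QuadraticFields.KroneckerSplitting
import Literature.NumberTheory.EllipticCurves.HeegnerPoints
import HarnessLib

/-!
# Crux `PrintCFram.BottomClassIndexLawFiveLe` (stmt-BirchSwinnertonDyer-20372), line `eisenstein-resource-bdp-line` (registry v15):
# THE OFF-LOCUS DICTIONARY (Dirichlet side) — the Kriz–Li character triple EXISTS class-wide modulo (4), and (4) is RIGID
# (cell `bsd-print-cfram`, width seat `bsd-line-cfram-p1-w3` g7; THEOREMS ONLY, `--supports` 20372; BSD is not proved by any of this)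

HONEST FRAMING. Nothing here is a statement about BSD; the crux C2 is CLASS-WIDE and stays OPEN; no stub is closed. Registry v15
(LEAD g10) restates the hypothesis of the two research stubs (`stub_kolyvaginUpper_borelCM_pairSum_offKrizLi`,
`stub_flatEisensteinIncl_cmRamified_offKrizLi`) as «NO CHARACTER DATA»: there is no imaginary quadratic `K''`, Heegner for `N_W`
with `d_{K''}` odd `< −4`, carrying a Kriz–Li triple `(ψ, ω, ε_{K''})` — `ψ` primitive, `ω` Teichmüller, the trace form `hss`,
(1), (3), `IsKroneckerCharacterOf K'' ε_{K''}` — together with Kriz–Li's Bernoulli hypothesis (4)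
`¬ ‖B_{1,ψ₀⁻¹ε_K}·B_{1,ψ₀ω⁻¹}‖_p ≤ p⁻¹`. This file is the DICTIONARY that turns «no character data» into a statement about
Bernoulli numbers ONLY (LEAD g10 wave 2026-08-28, ask (1)):

* §1 UNIQUENESS of the two rigid binders: `eq_of_isTeichmullerCharacter` (`p` odd), `eq_of_isKroneckerCharacterOf` (Dirichlet's
  theorem on primes in progressions, Mathlib, via `EisensteinPair.exists_prime_eq_not_dvd`).
* §2 `ε_K` EXISTS for EVERY quadratic field, `ℚ_p`-valued: `isKroneckerCharacterOf_kroneckerFourPadic` (even discriminants; port of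
  cell `bsd-cm`'s `RouteU.isKroneckerCharacterOf_kroneckerFour`, `ℚ_7 → ℚ_p`) and **`exists_isKroneckerCharacterOf`** (odd
  discriminants: part E `KrizLiBinders.exists_isKroneckerCharacterOf_of_discr`; even: part K-even + the port; the dichotomy is
  `Quadratic.isFundamentalDiscriminant_discr`).
* §3 (1a) **`exists_krizLiTriple_of_cmRamified`** — CLASS-WIDE EXISTENCE OF THE KRIZ–LI TRIPLE MODULO (4): for every `W` (CM,
  `CMRamified W p`, `5 ≤ p`) and every imaginary quadratic `K`, the conjuncts `hψ hω hss h1 h1' h3 hεK` of v15's character data hold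
  for some `(f, ψ, ω, ε_K)` (part W `KrizLiBinders.exists_krizLiBinders_of_cmRamified` + §2); `…_odd` records `ψ.Odd` as well.
* §4 (1b) **`bernoulliPair_eq_of_hss`** / **`bernoulliFour_iff_of_hss`** — RIGIDITY OF (4): two triples `(ψ, ω, ε_K)`,
  `(ψ', ω', ε_K')` at the same `(W, p, K)` (`p ≥ 5`, any elliptic `W`) with `hω hss hεK` have the SAME Bernoulli product, hence the
  same (4)-status (`ω' = ω`, `ε_K' = ε_K` by §1; `ψ' ∈ {ψ, ψ⁻¹ω}` and the swap-invariance of the product are w3 g3's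
  `EisensteinPair.bernoulliOnePrim_prod_eq_of_hss`). Primitivity of `ψ`, (1), (3) are NOT needed.
* Sequel `…OffLocusResidue` (§5): THE RESIDUE BY NAME — «no character data» ⟺ (4) fails for every / some admissible triple at
  every Heegner `K''` (`d` odd `< −4`), and, for an odd class character `ψ`, ⟺ `‖B_{1,ψ⁻¹}‖_p ≤ p⁻¹` ∨ ∀ `K''`: `‖B_{1,(ψε_{K''}ω⁻¹)~}‖_p ≤ p⁻¹`.

beyond-print theorem: NO (dictionary / plumbing). BSD is not proved by any of this; no summit statement is proved by this seat.

References: [KrizLi2019] Thm. 1.20 (pp. 7–8), Rem. 1.21 (p. 8), §2 (pp. 11–12), §7.1 (p. 43); [Washington1997] §5.1 (Teichmüller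
character); [Cox2013] §1.C Lemma 1.14, (1.18); [MontgomeryVaughan2007] Thm. 9.13; [Mazur1978] Prop. 6.3 (1).
-/

set_option autoImplicit false
-- summit-side namespace `Summit.BirchSwinnertonDyer.BirchSwinnertonDyer.…` (single-conjunct summit, D-0017 layout)
set_option linter.dupNamespace false

noncomputable section

open scoped Classical NumberTheorySymbols
open NumberField DirichletCharacter WeierstrassCurve
open Literature.NumberTheory.EllipticCurves Literature.NumberTheory.EllipticCurves.KrizLi2019
  Literature.NumberTheory.EllipticCurves.Rank1Residual Literature.NumberTheory.QuadraticFields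

namespace Summit.BirchSwinnertonDyer.BirchSwinnertonDyer.Theorems.PrintCFram.OffLocusDictionary

open Summit.BirchSwinnertonDyer.BirchSwinnertonDyer.Theorems.PrintCFram

variable {p : ℕ} [hp : Fact p.Prime]

/-! ## §1 Uniqueness of the two rigid binders `ω` and `ε_K` -/

/-- **The Teichmüller character is unique** (`p` odd): two `ℚ_p`-valued characters mod `p` with `ω(a) ≡ a (mod p)` at every
integer `a` prime to `p` coincide — their values at each unit are congruent, and congruent `p`-adic roots of unity are equal
(`EisensteinPair.eq_of_forall_norm_sub_lt_one`). [cite: Washington1997, §5.1 (ω(a) ≡ a mod p determines ω)] -/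
theorem eq_of_isTeichmullerCharacter (hp2 : p ≠ 2) {ω ω' : DirichletCharacter ℚ_[p] p}
    (hω : IsTeichmullerCharacter ω) (hω' : IsTeichmullerCharacter ω') : ω = ω' := by
  refine EisensteinPair.eq_of_forall_norm_sub_lt_one hp2 ω ω' fun u => ?_
  -- read the unit `u` as the integer `a = val u`, prime to `p`
  set a : ℕ := (u : ZMod p).val with ha
  have hau : ((a : ℤ) : ZMod p) = (u : ZMod p) := by rw [Int.cast_natCast, ha, ZMod.natCast_zmod_val]
  have hpa : ¬ ((p : ℤ) ∣ (a : ℤ)) := by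
    rw [Int.natCast_dvd_natCast]
    intro hdvd
    have hlt : a < p := ZMod.val_lt _
    have ha0 : a ≠ 0 := by
      rw [ha]; exact (ZMod.val_ne_zero _).mpr (Units.ne_zero u)
    exact ha0 (Nat.eq_zero_of_dvd_of_lt hdvd hlt)
  have h₁ := hω a hpa
  have h₂ := hω' a hpa
  rw [hau] at h₁ h₂
  have e : ω (u : ZMod p) - ω' (u : ZMod p) = (ω (u : ZMod p) - (a : ℤ)) + -(ω' (u : ZMod p) - (a : ℤ)) := by ring
  rw [e]
  refine lt_of_le_of_lt (IsUltrametricDist.norm_add_le_max _ _) (max_lt h₁ ?_)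
  rw [norm_neg]; exact h₂

/-- **The Kronecker character `ε_K` of `KrizLi2019.IsKroneckerCharacterOf K` is unique**: two characters mod `|d_K|` with the
same (split/inert) values at every prime `ℓ ∤ d_K` agree at every unit, because every unit class mod `|d_K|` contains a prime
`ℓ ∤ d_K` (Dirichlet, `EisensteinPair.exists_prime_eq_not_dvd`). [cite: KrizLi2019, §2 (p. 12, ε_K)] [cite: Cox2013, §1.C Lemma 1.14] -/
theorem eq_of_isKroneckerCharacterOf {K : Type} [Field K] [NumberField K]
    {ε ε' : DirichletCharacter ℚ_[p] (NumberField.discr K).natAbs}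
    (hε : IsKroneckerCharacterOf K ε) (hε' : IsKroneckerCharacterOf K ε') : ε = ε' := by
  haveI : NeZero (NumberField.discr K).natAbs := ⟨Int.natAbs_ne_zero.mpr (NumberField.discr_ne_zero K)⟩
  apply MulChar.ext
  intro u
  obtain ⟨ℓ, hℓ, hℓN, hℓu⟩ :=
    EisensteinPair.exists_prime_eq_not_dvd u (N := (NumberField.discr K).natAbs) (NeZero.ne _)
  have hnd : ¬ ((ℓ : ℤ) ∣ NumberField.discr K) := fun h => hℓN (Int.natCast_dvd.mp h)
  rw [← hℓu, hε.2 ℓ hℓ hnd, hε'.2 ℓ hℓ hnd]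

/-! ## §2 `ε_K` exists for every quadratic field (`ℚ_p`-valued) -/

/-- **`IsKroneckerCharacterOf` for an EVEN discriminant, `ℚ_p`-valued.** Let `M` be a quadratic field with `d_M = 4m`, and `χ` a
PRIMITIVE `ℚ_p`-valued character of level `k = 4|m|` with `χ(a) = (m / a)` at odd `a`. Then the lift of `χ` along `k ∣ |d_M|`
(in fact `k = |d_M|`) is the Kronecker character of `M`: primitive, and at every prime `ℓ ∤ d_M` (necessarily odd)
`χ(ℓ) = (m/ℓ) = (4m/ℓ) = 1` iff `ℓ` splits in `M` (`Quadratic.ncard_primesOver_eq_two_iff_legendreSym`).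
-- adapted from Summits/BirchSwinnertonDyer/Rank1Residual/X12/O11/RouteUKroneckerEven.lean (`isKroneckerCharacterOf_kroneckerFour`, ℚ_7-valued)
[cite: KrizLi2019, §2 (p. 12, "ε_K the quadratic character associated with K")] [cite: Cox2013, §1.C Lemma 1.14 and (1.18)] -/
theorem isKroneckerCharacterOf_kroneckerFourPadic {M : Type} [Field M] [NumberField M]
    (hM2 : Module.finrank ℚ M = 2) {m : ℤ} (hdM : NumberField.discr M = 4 * m)
    {k : ℕ} [NeZero k] (χ : DirichletCharacter ℚ_[p] k) (hχp : χ.IsPrimitive)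
    (hχ : ∀ a : ℕ, Odd a → χ a = (J(m | a) : ℚ_[p])) (hk : k = 4 * m.natAbs)
    (h : k ∣ (NumberField.discr M).natAbs) :
    IsKroneckerCharacterOf M (changeLevel h χ) := by
  have hnat : (NumberField.discr M).natAbs = k := by rw [hdM, hk, Int.natAbs_mul]; rfl
  refine ⟨?_, fun ℓ hℓ hnd => ?_⟩
  · rw [isPrimitive_def, conductor_changeLevel, hχp, hnat]
  · haveI := Fact.mk hℓ
    have hℓ2 : ℓ ≠ 2 := by rintro rfl; exact hnd (by rw [hdM]; exact Dvd.dvd.mul_right (by norm_num) m)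
    have hodd : Odd ℓ := hℓ.odd_of_ne_two hℓ2
    have hcop : IsCoprime (ℓ : ℤ) ((NumberField.discr M).natAbs : ℕ) := by
      rw [Int.isCoprime_iff_gcd_eq_one, Int.gcd_natCast_natCast, ← Nat.coprime_iff_gcd_eq_one,
        Nat.Prime.coprime_iff_not_dvd hℓ]
      intro hdvd; apply hnd
      exact Int.dvd_natAbs.mp (by exact_mod_cast hdvd)
    have hval : changeLevel h χ (ℓ : ZMod (NumberField.discr M).natAbs) = χ (ℓ : ZMod k) := by
      have := changeLevel_eq_cast_of_dvd' χ h hcop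
      simpa [Int.cast_natCast] using this
    rw [hval, hχ ℓ hodd, ← jacobiSym.legendreSym.to_jacobiSym]
    -- `(d_M / ℓ) = (4m / ℓ) = (m / ℓ)`
    have hℓm : ¬ ((ℓ : ℤ) ∣ m) := fun hd => hnd (by rw [hdM]; exact hd.mul_left 4)
    have hm0 : ((m : ℤ) : ZMod ℓ) ≠ 0 := by rwa [Ne, ZMod.intCast_zmod_eq_zero_iff_dvd]
    have h20 : ((2 : ℤ) : ZMod ℓ) ≠ 0 := by
      rw [Ne, ZMod.intCast_zmod_eq_zero_iff_dvd]
      intro hd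
      exact hℓ2 ((Nat.prime_dvd_prime_iff_eq hℓ Nat.prime_two).mp (by exact_mod_cast hd))
    have hleg : legendreSym ℓ (NumberField.discr M) = legendreSym ℓ m := by
      rw [hdM, legendreSym.mul, show (4 : ℤ) = 2 ^ 2 by norm_num, legendreSym.sq_one' ℓ h20, one_mul]
    rcases legendreSym.eq_one_or_neg_one ℓ hm0 with h1 | h1
    · rw [h1, if_pos ((Quadratic.ncard_primesOver_eq_two_iff_legendreSym hM2 hℓ2).mpr (by rw [hleg, h1])),
        Int.cast_one]
    · have hs : ((Ideal.span {(ℓ : ℤ)}).primesOver (𝓞 M)).ncard ≠ 2 := fun hs => by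
        have := (Quadratic.ncard_primesOver_eq_two_iff_legendreSym hM2 hℓ2).mp hs
        rw [hleg, h1] at this; norm_num at this
      rw [h1, if_neg hs, Int.cast_neg, Int.cast_one]

/-- **`ε_K` EXISTS for every quadratic field `M`**, `ℚ_p`-valued: there is `ε : DirichletCharacter ℚ_[p] |d_M|` with
`KrizLi2019.IsKroneckerCharacterOf M ε` — the Kronecker symbol `(d_M / ·)` as a primitive character mod `|d_M|` (Cox Lemma 1.14).
Odd `d_M = ±m`: the Jacobi character `J(· | m)` (part E `KrizLiBinders.exists_isKroneckerCharacterOf_of_discr`); even `d_M = 4m`,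
`m ≡ 2, 3 (mod 4)` squarefree: `[· odd]·J(m | ·)` mod `4|m|` (part K-even `KrizLiBinders.exists_kroneckerFourPadic`,
`isPrimitive_of_forall_eq_kroneckerFour'`) and `isKroneckerCharacterOf_kroneckerFourPadic`; the dichotomy is
`Quadratic.isFundamentalDiscriminant_discr`. [cite: Cox2013, §1.C Lemma 1.14 and (1.18)] [cite: KrizLi2019, §2 (p. 12, ε_K)] -/
theorem exists_isKroneckerCharacterOf {M : Type} [Field M] [NumberField M] (hM2 : Module.finrank ℚ M = 2) :
    ∃ ε : DirichletCharacter ℚ_[p] (NumberField.discr M).natAbs, IsKroneckerCharacterOf M ε := by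
  set D := NumberField.discr M with hD
  have hD0 : D ≠ 0 := NumberField.discr_ne_zero M
  rcases Quadratic.isFundamentalDiscriminant_discr (K := M) hM2 with ⟨h4, hsq, -⟩ | ⟨h4, hm4, hsq⟩
  · -- odd discriminant `D = ±m`, `m = |D|` squarefree
    have hsqn : Squarefree D.natAbs := Int.squarefree_natAbs.mpr hsq
    have hsign : (NumberField.discr M = (D.natAbs : ℕ) ∧ D.natAbs % 4 = 1) ∨
        (NumberField.discr M = -((D.natAbs : ℕ) : ℤ) ∧ D.natAbs % 4 = 3) := by
      rcases lt_or_gt_of_ne hD0 with hneg | hpos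
      · right
        have e : ((D.natAbs : ℕ) : ℤ) = -D := Int.ofNat_natAbs_of_nonpos hneg.le
        refine ⟨by rw [e, neg_neg], ?_⟩
        omega
      · left
        have e : ((D.natAbs : ℕ) : ℤ) = D := Int.natAbs_of_nonneg hpos.le
        refine ⟨by rw [e], ?_⟩
        omega
    obtain ⟨ε, hε, -⟩ := KrizLiBinders.exists_isKroneckerCharacterOf_of_discr (p := p) hM2 hsqn hsign
    exact ⟨ε, hε⟩
  · -- even discriminant `D = 4m`, `m ≡ 2, 3 (mod 4)` squarefree
    set m : ℤ := D / 4 with hm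
    have hdM : NumberField.discr M = 4 * m := by rw [← hD, hm, Int.mul_ediv_cancel' h4]
    have hm0 : m ≠ 0 := by
      rintro h0; apply hD0; rw [hD, hdM, h0, mul_zero]
    haveI : NeZero (4 * m.natAbs) := ⟨Nat.mul_ne_zero (by norm_num) (Int.natAbs_ne_zero.mpr hm0)⟩
    obtain ⟨χ, hχ⟩ := KrizLiBinders.exists_kroneckerFourPadic (p := p) m hm0 (k := 4 * m.natAbs) rfl
    have hprim : χ.IsPrimitive := KrizLiBinders.isPrimitive_of_forall_eq_kroneckerFour' rfl hm4 hsq hχ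
    have hk : 4 * m.natAbs ∣ (NumberField.discr M).natAbs := by
      rw [hdM, Int.natAbs_mul]; exact dvd_rfl
    exact ⟨changeLevel hk χ, isKroneckerCharacterOf_kroneckerFourPadic hM2 hdM χ hprim
      (KrizLiBinders.apply_eq_jacobiSym_of_odd hχ) rfl hk⟩

/-! ## §3 (1a) CLASS-WIDE EXISTENCE OF THE KRIZ–LI TRIPLE MODULO (4) -/

/-- **(1a) The Kriz–Li triple exists on the whole class, for every imaginary quadratic field — everything except (4) and the
field-side conditions.** For every elliptic `W/ℚ` with CM, every prime `p ≥ 5` ramified in the CM field (`CMRamified W p`, the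
seven leaf classes) and every imaginary quadratic `K`: there are `(f, ψ, ω, ε_K)` with — VERBATIM as registry v15's character data
binds them — `ψ` primitive, `ω` Teichmüller, the trace form `hss` (`∀ ℓ ∤ p·N_W, ‖a_ℓ(W) − (ψ(ℓ) + ψ⁻¹(ℓ)ω(ℓ))‖_p < 1`), (1)
`ψ(p) ≠ 1`, `(ψ⁻¹ω)(p) ≠ 1`, (3) at every additive `ℓ ≠ p`, and `IsKroneckerCharacterOf K ε_K`. Source: part W
`KrizLiBinders.exists_krizLiBinders_of_cmRamified` (`ψ = χ_e·ω^k` of conductor `p·m` from the class-wide trace form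
`EisensteinTraceForm.traceForm_of_cmRamified_squarefree`; (1)/(3) automatic because `p` and the additive primes divide the
conductor) and §2 `exists_isKroneckerCharacterOf` (only `[K : ℚ] = 2` of `hK` is used). So «no character data at `K`» is EXACTLY the
failure of (4) (§5). [cite: KrizLi2019, Thm. 1.20 (pp. 7–8), Rem. 1.21 (p. 8), §2 (pp. 11–12)] [cite: Mazur1978, Prop. 6.3 (1) (p. 153)]
[cite: Cox2013, §1.C Lemma 1.14] -/
theorem exists_krizLiTriple_of_cmRamified (W : WeierstrassCurve ℚ) [W.IsElliptic] [W.IsGloballyMinimal] (p : ℕ) [Fact p.Prime]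
    (hCM : W.HasCM) (hram : CMRamified W p) (h5 : 5 ≤ p) (K : Type) [Field K] [NumberField K] (hK : IsImaginaryQuadratic K) :
    ∃ (f : ℕ) (_ : NeZero f) (ψ : DirichletCharacter ℚ_[p] f) (ω : DirichletCharacter ℚ_[p] p)
      (εK : DirichletCharacter ℚ_[p] (NumberField.discr K).natAbs),
      ψ.IsPrimitive ∧ KrizLi2019.IsTeichmullerCharacter ω ∧
      (∀ ℓ : ℕ, ℓ.Prime → ¬ (ℓ ∣ p * W.conductorNorm ℤ) →
        ‖((W.LFunction ℓ : ℤ) : ℚ_[p]) - (ψ (ℓ : ZMod f) + ψ⁻¹ (ℓ : ZMod f) * ω (ℓ : ZMod p))‖ < 1) ∧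
      ψ (p : ZMod f) ≠ 1 ∧ KrizLi2019.primVal (KrizLi2019.invMulOmega ψ ω) p ≠ 1 ∧
      (∀ ℓ : ℕ, (hℓ : ℓ.Prime) → ℓ ≠ p →
        (haveI := Fact.mk hℓ; ¬ W.HasGoodReductionAtPrime ℓ ∧ ¬ W.HasMultiplicativeReductionAtPrime ℓ) →
        ψ (ℓ : ZMod f) ≠ 1 ∧ KrizLi2019.primVal (KrizLi2019.invMulOmega ψ ω) ℓ ≠ 1) ∧
      KrizLi2019.IsKroneckerCharacterOf K εK := by
  obtain ⟨f, hf, ψ, ω, hprim, hω, hss, ⟨h1, h1'⟩, h3, -⟩ := KrizLiBinders.exists_krizLiBinders_of_cmRamified W hCM hram h5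
  obtain ⟨εK, hεK⟩ := exists_isKroneckerCharacterOf (p := p) hK.1
  exact ⟨f, hf, ψ, ω, εK, hprim, hω, hss, h1, h1', h3, hεK⟩

/-- **(1a) with `ψ` ODD** (the class character of part W is odd: `χ_e(−1)(−1)^k = −1`), so that w2 g4's splitting of (4) into
«class factor × `K''`-factor» (`RegularLocusBernoulliPair.krizLi_bernoulli_hypothesis_iff_of_not_even`, p634386) applies to it.
[cite: KrizLi2019, Thm. 1.20 (pp. 7–8), §7.1 (p. 43)] [cite: Mazur1978, Prop. 6.3 (1) (p. 153)] -/
theorem exists_krizLiTriple_odd_of_cmRamified (W : WeierstrassCurve ℚ) [W.IsElliptic] (p : ℕ) [Fact p.Prime]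
    (hCM : W.HasCM) (hram : CMRamified W p) (h5 : 5 ≤ p) (K : Type) [Field K] [NumberField K]
    (hK2 : Module.finrank ℚ K = 2) :
    ∃ (f : ℕ) (_ : NeZero f) (ψ : DirichletCharacter ℚ_[p] f) (ω : DirichletCharacter ℚ_[p] p)
      (εK : DirichletCharacter ℚ_[p] (NumberField.discr K).natAbs),
      ψ.IsPrimitive ∧ ψ.Odd ∧ KrizLi2019.IsTeichmullerCharacter ω ∧
      (∀ ℓ : ℕ, ℓ.Prime → ¬ (ℓ ∣ p * W.conductorNorm ℤ) →
        ‖((W.LFunction ℓ : ℤ) : ℚ_[p]) - (ψ (ℓ : ZMod f) + ψ⁻¹ (ℓ : ZMod f) * ω (ℓ : ZMod p))‖ < 1) ∧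
      ψ (p : ZMod f) ≠ 1 ∧ KrizLi2019.primVal (KrizLi2019.invMulOmega ψ ω) p ≠ 1 ∧
      (∀ ℓ : ℕ, (hℓ : ℓ.Prime) → ℓ ≠ p →
        (haveI := Fact.mk hℓ; ¬ W.HasGoodReductionAtPrime ℓ ∧ ¬ W.HasMultiplicativeReductionAtPrime ℓ) →
        ψ (ℓ : ZMod f) ≠ 1 ∧ KrizLi2019.primVal (KrizLi2019.invMulOmega ψ ω) ℓ ≠ 1) ∧
      KrizLi2019.IsKroneckerCharacterOf K εK := by
  obtain ⟨f, hf, ψ, ω, hprim, hω, hss, ⟨h1, h1'⟩, h3, hodd⟩ := KrizLiBinders.exists_krizLiBinders_of_cmRamified W hCM hram h5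
  obtain ⟨εK, hεK⟩ := exists_isKroneckerCharacterOf (p := p) hK2
  exact ⟨f, hf, ψ, ω, εK, hprim, hodd, hω, hss, h1, h1', h3, hεK⟩

/-! ## §4 (1b) RIGIDITY OF (4): the Bernoulli product depends on `(W, p, K)` only -/

/-- **(1b) The Bernoulli product `B_{1,ψ₀⁻¹ε_K}·B_{1,ψ₀ω⁻¹}` is the same for ALL Kriz–Li triples at `(W, p, K)`.** For an elliptic
`W/ℚ`, `p ≥ 5`, a number field `K`, and two triples `(ψ, ω, ε_K)`, `(ψ', ω', ε_K')` (levels `f`, `f'` arbitrary) with `ω, ω'`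
Teichmüller, both trace forms `hss`, `hss'` for `W`, and both `ε_K, ε_K'` Kronecker characters of `K`: the two products are EQUAL.
`ω' = ω` (`eq_of_isTeichmullerCharacter`), `ε_K' = ε_K` (`eq_of_isKroneckerCharacterOf`), and for fixed `(ω, ε_K)` the product is
intrinsic in `ψ` (`EisensteinPair.bernoulliOnePrim_prod_eq_of_hss`: `ψ'↑ ∈ {ψ↑, ψ⁻¹↑ω↑}` by Artin independence, and the product is
swap-invariant — FMS §7.1 «interchange ψ and ψ⁻¹ω»). Primitivity, (1), (3) are not used. [cite: KrizLi2019, Thm. 1.20 (p. 8) and §7.1 (p. 43)] -/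
theorem bernoulliPair_eq_of_hss (W : WeierstrassCurve ℚ) [W.IsElliptic] (h5 : 5 ≤ p)
    (K : Type) [Field K] [NumberField K] {f f' : ℕ} [NeZero f] [NeZero f']
    (ψ : DirichletCharacter ℚ_[p] f) (ψ' : DirichletCharacter ℚ_[p] f') (ω ω' : DirichletCharacter ℚ_[p] p)
    (εK εK' : DirichletCharacter ℚ_[p] (NumberField.discr K).natAbs)
    (hω : IsTeichmullerCharacter ω) (hω' : IsTeichmullerCharacter ω')
    (hss : ∀ ℓ : ℕ, ℓ.Prime → ¬ (ℓ ∣ p * W.conductorNorm ℤ) →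
      ‖((W.LFunction ℓ : ℤ) : ℚ_[p]) - (ψ (ℓ : ZMod f) + ψ⁻¹ (ℓ : ZMod f) * ω (ℓ : ZMod p))‖ < 1)
    (hss' : ∀ ℓ : ℕ, ℓ.Prime → ¬ (ℓ ∣ p * W.conductorNorm ℤ) →
      ‖((W.LFunction ℓ : ℤ) : ℚ_[p]) - (ψ' (ℓ : ZMod f') + ψ'⁻¹ (ℓ : ZMod f') * ω' (ℓ : ZMod p))‖ < 1)
    (hεK : IsKroneckerCharacterOf K εK) (hεK' : IsKroneckerCharacterOf K εK') :
    bernoulliOnePrim (bernoulliCharOne ψ' εK') * bernoulliOnePrim (bernoulliCharTwo ψ' εK' ω') =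
      bernoulliOnePrim (bernoulliCharOne ψ εK) * bernoulliOnePrim (bernoulliCharTwo ψ εK ω) := by
  have hp2 : p ≠ 2 := by omega
  obtain rfl : ω = ω' := eq_of_isTeichmullerCharacter hp2 hω hω'
  obtain rfl : εK = εK' := eq_of_isKroneckerCharacterOf hεK hεK'
  exact EisensteinPair.bernoulliOnePrim_prod_eq_of_hss h5 W ψ ψ' ω hω εK hss hss'

/-- **(1b) RIGIDITY OF (4)** (LEAD g10's requested form): under the hypotheses of `bernoulliPair_eq_of_hss`,
`‖B_{1,ψ₀⁻¹ε_K}·B_{1,ψ₀ω⁻¹}‖_p ≤ p⁻¹ ↔ ‖B_{1,ψ'₀⁻¹ε_K'}·B_{1,ψ'₀ω'⁻¹}‖_p ≤ p⁻¹` — Kriz–Li's hypothesis (4) (its negation) holds for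
one admissible triple at `(W, p, K)` iff it holds for every other. [cite: KrizLi2019, Thm. 1.20 (p. 8) and §7.1 (p. 43)] -/
theorem bernoulliFour_iff_of_hss (W : WeierstrassCurve ℚ) [W.IsElliptic] (h5 : 5 ≤ p)
    (K : Type) [Field K] [NumberField K] {f f' : ℕ} [NeZero f] [NeZero f']
    (ψ : DirichletCharacter ℚ_[p] f) (ψ' : DirichletCharacter ℚ_[p] f') (ω ω' : DirichletCharacter ℚ_[p] p)
    (εK εK' : DirichletCharacter ℚ_[p] (NumberField.discr K).natAbs)
    (hω : IsTeichmullerCharacter ω) (hω' : IsTeichmullerCharacter ω')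
    (hss : ∀ ℓ : ℕ, ℓ.Prime → ¬ (ℓ ∣ p * W.conductorNorm ℤ) →
      ‖((W.LFunction ℓ : ℤ) : ℚ_[p]) - (ψ (ℓ : ZMod f) + ψ⁻¹ (ℓ : ZMod f) * ω (ℓ : ZMod p))‖ < 1)
    (hss' : ∀ ℓ : ℕ, ℓ.Prime → ¬ (ℓ ∣ p * W.conductorNorm ℤ) →
      ‖((W.LFunction ℓ : ℤ) : ℚ_[p]) - (ψ' (ℓ : ZMod f') + ψ'⁻¹ (ℓ : ZMod f') * ω' (ℓ : ZMod p))‖ < 1)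
    (hεK : IsKroneckerCharacterOf K εK) (hεK' : IsKroneckerCharacterOf K εK') :
    (‖bernoulliOnePrim (bernoulliCharOne ψ εK) * bernoulliOnePrim (bernoulliCharTwo ψ εK ω)‖ ≤ (p : ℝ)⁻¹) ↔
      ‖bernoulliOnePrim (bernoulliCharOne ψ' εK') * bernoulliOnePrim (bernoulliCharTwo ψ' εK' ω')‖ ≤ (p : ℝ)⁻¹ := by
  rw [bernoulliPair_eq_of_hss W h5 K ψ ψ' ω ω' εK εK' hω hω' hss hss' hεK hεK']


end Summit.BirchSwinnertonDyer.BirchSwinnertonDyer.Theorems.PrintCFram.OffLocusDictionary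

end
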